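import Summits.RiemannHypothesis.RiemannHypothesis.Theorems.SemilocalDeletionToeplitzCombs
import HarnessLib

/-!
# The half-room law with a LINEAR constant: `λ_min(S∖p; m·log p/2 + δ) ≤ (vᵀA_m(p)v)/|v|² + (m+1)·λ_min(S; δ)`

`SemilocalDeletionToeplitzCombs.lean` bounds the `Q_S`-cost of a comb of `m+1` translated blocks by `2^m·|v|²·Re Q_S(h)`, iterating the
two-term sub-additivity `Re Q_S(f + g) ≤ 2Re Q_S(f) + 2Re Q_S(g)` of a nonnegative form.  The sharp count is the POLARIZATION IDENTITY of
the quadratic form `Q_S` (its cross form `C_S(f, g) = W_S(f ⋆ g̃) + W_S(g ⋆ f̃)` is symmetric and additive):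

  `Q_S(Σ_{i≤n} f_i) + Σ_{i<j≤n} Q_S(f_i − f_j) = (n+1)·Σ_{i≤n} Q_S(f_i)`   (`weilSemilocalQuadratic_sum_add_sum_sub`),

so under `Q_S ≥ 0` on the window every difference costs `≥ 0` and `Re Q_S(Σ f_i) ≤ (n+1)·Σ Re Q_S(f_i)` (`re_weilSemilocalQuadratic_sum_le`);
for the comb `f_i = v_i·h(· + mL/2 − iL)`: `Re Q_S(comb) ≤ (m+1)·|v|²·Re Q_S(h)` (`re_weilSemilocalQuadratic_comb_le_linear`), whence the
half-room laws of the Combs file with `2^m` replaced by `m + 1` (`semilocalGroundEnergy_erase_comb_le_linear`,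
`semilocalGroundEnergy_erase_top_le_comb_linear`, `semilocalGroundEnergy_erase_sector_le_comb_linear`):

  `λ_min(S∖{p}; m·log p/2 + δ; sector sσ)·|v|² ≤ vᵀA_m(p)v + (m+1)·|v|²·λ_min(S; δ; sector σ)`.

(`m = 6`: `7` instead of `64`.)  Nothing here bears on RH; these are statements about truncated Weil forms.
-/

set_option linter.dupNamespace false

noncomputable section

open Complex Filter Set MeasureTheory
open scoped Real Topology ComplexConjugate

namespace Summit.RiemannHypothesis.RiemannHypothesis.Theorems.SemilocalDeletionToeplitzCombsLinear

open Literature.NumberTheory.LFunctions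
open Summit.RiemannHypothesis.RiemannHypothesis.Theorems.HandoffSemilocalEnergy
open Summit.RiemannHypothesis.RiemannHypothesis.Theorems.HandoffSemilocalParitySplit
open Summit.RiemannHypothesis.RiemannHypothesis.Theorems.SemilocalDeletionToeplitzFloor
open Summit.RiemannHypothesis.RiemannHypothesis.Theorems.SemilocalDeletionToeplitzCombs

/-- Local copy of `SemilocalDeletionToeplitzHalfRoom.tsupport_subset_Icc_of_apply` (that module has no hub olean at filing time):
a function vanishing outside `[a, b]` has `tsupport ⊆ [a, b]`. -/
private theorem tsupport_subset_Icc_of_apply {F : ℝ → ℂ} {a b : ℝ} (hF : ∀ t, F t ≠ 0 → t ∈ Icc a b) :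
    tsupport F ⊆ Icc a b :=
  (isClosed_Icc.closure_subset_iff).2 fun t ht ↦ hF t (Function.mem_support.1 ht)

/-- Local copy of `SemilocalDeletionToeplitzHalfRoom.mem_Icc_of_apply_ne_zero`: nonzero values of a test function on `[a, b]` live in `[a, b]`. -/
private theorem mem_Icc_of_apply_ne_zero {F : ℝ → ℂ} {a b : ℝ} (hF : tsupport F ⊆ Icc a b) {t : ℝ} (ht : F t ≠ 0) :
    t ∈ Icc a b :=
  hF (subset_tsupport _ (Function.mem_support.2 ht))

/-- Local copy of `SemilocalDeletionToeplitzHalfRoom.weilSemilocalQuadratic_smul_translate`: `Q_S(v·h(· + a)) = v²·Q_S(h)` for real `v`. -/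
private theorem weilSemilocalQuadratic_smul_translate (S : Finset ℕ) (h : ℝ → ℂ) (v a : ℝ) :
    weilSemilocalQuadratic S (fun t ↦ (v : ℂ) * h (t + a)) = ((v ^ 2 : ℝ) : ℂ) * weilSemilocalQuadratic S h := by
  rw [weilSemilocalQuadratic_const_mul, Complex.normSq_ofReal]
  unfold weilSemilocalQuadratic
  rw [weilConv_weilReflect_translate]; push_cast; ring

variable {h : ℝ → ℂ} {S : Finset ℕ} {p : ℕ} {δ L c : ℝ} {P : (ℝ → ℂ) → Prop} {v : ℕ → ℝ}

/-! ## §1  The cross form of `Q_S`: additivity and the difference formula -/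

/-- Finite sums of Weil test functions are Weil test functions. -/
theorem isWeilTest_sum {f : ℕ → ℝ → ℂ} (hf : ∀ i, IsWeilTest (f i)) (n : ℕ) :
    IsWeilTest (∑ i ∈ Finset.range n, f i) := by
  induction n with
  | zero =>
    rw [Finset.range_zero, Finset.sum_empty, show (0 : ℝ → ℂ) = fun t ↦ (0 : ℂ) * f 0 t from funext fun t ↦ by simp]
    exact (hf 0).const_mul 0
  | succ n ih => rw [Finset.sum_range_succ]; exact ih.add (hf n)

/-- The cross form `C_S(f, g) := W_S(f ⋆ g̃) + W_S(g ⋆ f̃)` is additive in its first argument (test functions). -/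
theorem cross_add_left (S : Finset ℕ) {f₁ f₂ g : ℝ → ℂ} (hf₁ : IsWeilTest f₁) (hf₂ : IsWeilTest f₂) (hg : IsWeilTest g) :
    weilSemilocalFunctional S (weilConv (f₁ + f₂) (weilReflect g)) + weilSemilocalFunctional S (weilConv g (weilReflect (f₁ + f₂))) =
      (weilSemilocalFunctional S (weilConv f₁ (weilReflect g)) + weilSemilocalFunctional S (weilConv g (weilReflect f₁))) +
        (weilSemilocalFunctional S (weilConv f₂ (weilReflect g)) + weilSemilocalFunctional S (weilConv g (weilReflect f₂))) := by
  have hg' := hg.weilReflect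
  have hf₁' := hf₁.weilReflect
  have hf₂' := hf₂.weilReflect
  rw [weilReflect_add, weilConv_add_left hf₁ hf₂ hg', weilConv_add_right hg hf₁' hf₂',
    weilSemilocalFunctional_add S (hf₁.weilConv hg') (hf₂.weilConv hg'),
    weilSemilocalFunctional_add S (hg.weilConv hf₁') (hg.weilConv hf₂')]
  ring

/-- The cross form of a finite sum: `C_S(Σ_{i<n} f_i, g) = Σ_{i<n} C_S(f_i, g)`. -/
theorem cross_sum_left (S : Finset ℕ) {f : ℕ → ℝ → ℂ} (hf : ∀ i, IsWeilTest (f i)) {g : ℝ → ℂ} (hg : IsWeilTest g) (n : ℕ) :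
    weilSemilocalFunctional S (weilConv (∑ i ∈ Finset.range n, f i) (weilReflect g)) +
        weilSemilocalFunctional S (weilConv g (weilReflect (∑ i ∈ Finset.range n, f i))) =
      ∑ i ∈ Finset.range n, (weilSemilocalFunctional S (weilConv (f i) (weilReflect g)) +
        weilSemilocalFunctional S (weilConv g (weilReflect (f i)))) := by
  induction n with
  | zero =>
    simp only [Finset.range_zero, Finset.sum_empty]
    have h0 : weilConv (0 : ℝ → ℂ) (weilReflect g) = 0 := by
      funext t; simp [weilConv, convolution]
    have h0' : weilConv g (weilReflect (0 : ℝ → ℂ)) = 0 := by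
      funext t; simp [weilConv, convolution, weilReflect]
    have hW0 : weilSemilocalFunctional S (0 : ℝ → ℂ) = 0 := by
      have := weilSemilocalFunctional_const_mul S (0 : ℂ) g
      rw [zero_mul] at this
      rwa [show (fun t : ℝ ↦ (0 : ℂ) * g t) = (0 : ℝ → ℂ) from funext fun t ↦ by simp] at this
    rw [h0, h0', hW0, add_zero]
  | succ n ih =>
    rw [Finset.sum_range_succ, Finset.sum_range_succ, cross_add_left S (isWeilTest_sum hf n) (hf n) hg, ih]

/-- `Q_S(f − g) = Q_S f + Q_S g − C_S(f, g)`. -/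
theorem weilSemilocalQuadratic_sub (S : Finset ℕ) {f g : ℝ → ℂ} (hf : IsWeilTest f) (hg : IsWeilTest g) :
    weilSemilocalQuadratic S (f - g) = weilSemilocalQuadratic S f + weilSemilocalQuadratic S g -
      (weilSemilocalFunctional S (weilConv f (weilReflect g)) + weilSemilocalFunctional S (weilConv g (weilReflect f))) := by
  have hng : IsWeilTest (-g) := by convert hg.const_mul (-1) using 1; funext t; simp
  have h2 := weilSemilocalQuadratic_add S hf hng
  have hQn : weilSemilocalQuadratic S (-g) = weilSemilocalQuadratic S g := by
    rw [show -g = fun t ↦ (-1 : ℂ) * g t by funext t; simp, weilSemilocalQuadratic_const_mul]; simp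
  have hcl : weilConv f (weilReflect (-g)) = -weilConv f (weilReflect g) := by
    rw [show weilReflect (-g) = fun t ↦ (-1 : ℂ) * weilReflect g t by funext t; simp [weilReflect], weilConv_const_mul_right]
    funext t; simp
  have hcr : weilConv (-g) (weilReflect f) = -weilConv g (weilReflect f) := by
    rw [show -g = fun t ↦ (-1 : ℂ) * g t by funext t; simp, weilConv_const_mul_left]; funext t; simp
  have hWn : ∀ K : ℝ → ℂ, weilSemilocalFunctional S (-K) = -weilSemilocalFunctional S K := fun K ↦ by
    rw [show -K = fun t ↦ (-1 : ℂ) * K t by funext t; simp, weilSemilocalFunctional_const_mul, neg_one_mul]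
  rw [hQn, hcl, hcr, hWn, hWn] at h2
  rw [sub_eq_add_neg, h2]
  ring

/-! ## §2  Polarization: `Q_S(Σ f_i) + Σ_{i<j} Q_S(f_i − f_j) = (n+1)·Σ Q_S(f_i)` -/

/-- **Polarization identity** for `n + 1` test functions. -/
theorem weilSemilocalQuadratic_sum_add_sum_sub (S : Finset ℕ) {f : ℕ → ℝ → ℂ} (hf : ∀ i, IsWeilTest (f i)) (n : ℕ) :
    weilSemilocalQuadratic S (∑ i ∈ Finset.range (n + 1), f i) +
        ∑ j ∈ Finset.range (n + 1), ∑ i ∈ Finset.range j, weilSemilocalQuadratic S (f i - f j) =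
      (n + 1) * ∑ i ∈ Finset.range (n + 1), weilSemilocalQuadratic S (f i) := by
  induction n with
  | zero => simp
  | succ n ih =>
    rw [Finset.sum_range_succ f (n + 1), weilSemilocalQuadratic_add S (isWeilTest_sum hf (n + 1)) (hf (n + 1)),
      cross_sum_left S hf (hf (n + 1)) (n + 1), Finset.sum_range_succ _ (n + 1),
      Finset.sum_range_succ (fun i ↦ weilSemilocalQuadratic S (f i)) (n + 1)]
    have hsub : ∑ i ∈ Finset.range (n + 1), weilSemilocalQuadratic S (f i - f (n + 1)) =
        ∑ i ∈ Finset.range (n + 1), weilSemilocalQuadratic S (f i) + (n + 1) * weilSemilocalQuadratic S (f (n + 1)) -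
          ∑ i ∈ Finset.range (n + 1), (weilSemilocalFunctional S (weilConv (f i) (weilReflect (f (n + 1)))) +
            weilSemilocalFunctional S (weilConv (f (n + 1)) (weilReflect (f i)))) := by
      rw [Finset.sum_congr rfl fun i _ ↦ weilSemilocalQuadratic_sub S (hf i) (hf (n + 1)), Finset.sum_sub_distrib,
        Finset.sum_add_distrib, Finset.sum_const, Finset.card_range]
      simp only [nsmul_eq_mul]
      push_cast; ring
    rw [hsub]
    push_cast
    linear_combination ih

/-- **Jensen for a nonnegative form:** under `Q_S ≥ 0` on `C(c)`, test functions `f_0, …, f_n` on `[−c, c]` satisfy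
`Re Q_S(Σ f_i) ≤ (n+1)·Σ Re Q_S(f_i)`. -/
theorem re_weilSemilocalQuadratic_sum_le (hpos : WeilSemilocalPositivityOn S c) {f : ℕ → ℝ → ℂ} (hf : ∀ i, IsWeilTest (f i))
    (hfs : ∀ i, tsupport (f i) ⊆ Icc (-c) c) (n : ℕ) :
    (weilSemilocalQuadratic S (∑ i ∈ Finset.range (n + 1), f i)).re ≤
      (n + 1) * ∑ i ∈ Finset.range (n + 1), (weilSemilocalQuadratic S (f i)).re := by
  have hid := congrArg Complex.re (weilSemilocalQuadratic_sum_add_sum_sub S hf n)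
  rw [Complex.add_re, Complex.re_sum] at hid
  have hnn : 0 ≤ ∑ j ∈ Finset.range (n + 1), (∑ i ∈ Finset.range j, weilSemilocalQuadratic S (f i - f j)).re := by
    refine Finset.sum_nonneg fun j _ ↦ ?_
    rw [Complex.re_sum]
    refine Finset.sum_nonneg fun i _ ↦ hpos _ ((hf i).sub (hf j)) ?_
    refine tsupport_subset_Icc_of_apply fun t ht ↦ ?_
    by_cases hft : f i t = 0
    · exact mem_Icc_of_apply_ne_zero (hfs j) (fun h0 ↦ ht (by simp [hft, h0]) : f j t ≠ 0)
    · exact mem_Icc_of_apply_ne_zero (hfs i) hft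
  have hr : ((↑n + 1 : ℂ) * ∑ i ∈ Finset.range (n + 1), weilSemilocalQuadratic S (f i)).re =
      (n + 1) * ∑ i ∈ Finset.range (n + 1), (weilSemilocalQuadratic S (f i)).re := by
    rw [show (↑n + 1 : ℂ) = ((n + 1 : ℝ) : ℂ) by push_cast; ring, Complex.re_ofReal_mul, Complex.re_sum]
  linarith [hid, hr]

/-! ## §3  The comb costs at most `m + 1` blocks per unit mass -/

/-- **Linear comb cost:** under `Q_S ≥ 0` on `C(mL/2 + δ)`, `h ∈ C(δ)`, `L ≥ 0`, for every `n ≤ m`: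
`Re Q_S(Σ_{i≤n} v_i h(· + mL/2 − iL)) ≤ (n+1)·(Σ_{i≤n} v_i²)·Re Q_S(h)`. -/
theorem re_weilSemilocalQuadratic_comb_le_linear (hh : IsWeilTest h) (hsupp : tsupport h ⊆ Icc (-δ) δ) (hL : 0 ≤ L) {m : ℕ}
    (hpos : WeilSemilocalPositivityOn S (m * L / 2 + δ)) (v : ℕ → ℝ) {n : ℕ} (hn : n ≤ m) :
    (weilSemilocalQuadratic S fun t ↦ ∑ i ∈ Finset.range (n + 1), (v i : ℂ) * h (t + m * L / 2 - i * L)).re ≤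
      (n + 1) * (∑ i ∈ Finset.range (n + 1), v i ^ 2) * (weilSemilocalQuadratic S h).re := by
  set f : ℕ → ℝ → ℂ := fun i t ↦ (v i : ℂ) * h (t + (m * L / 2 - i * L)) with hfdef
  have hf : ∀ i, IsWeilTest (f i) := fun i ↦ (isWeilTest_translate hh _).const_mul _
  have hfs : ∀ i ∈ Finset.range (n + 1), tsupport (f i) ⊆ Icc (-(m * L / 2 + δ)) (m * L / 2 + δ) := by
    intro i hi
    have him : (i : ℝ) ≤ m := by exact_mod_cast (Nat.lt_succ_iff.1 (Finset.mem_range.1 hi)).trans hn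
    refine tsupport_subset_Icc_of_apply fun t ht ↦ ?_
    have := mem_Icc_of_apply_ne_zero hsupp (right_ne_zero_of_mul ht)
    have h0 : (0 : ℝ) ≤ i := by positivity
    rw [mem_Icc] at this ⊢; constructor <;> nlinarith [this.1, this.2]
  -- replace the blocks outside `range (n+1)` by zero so that the support hypothesis is global
  set f' : ℕ → ℝ → ℂ := fun i ↦ if i ≤ n then f i else 0 with hf'def
  have hf' : ∀ i, IsWeilTest (f' i) := fun i ↦ by
    by_cases hi : i ≤ n
    · simpa [hf'def, hi] using hf i
    · simp only [hf'def, hi, if_false]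
      rw [show (0 : ℝ → ℂ) = fun t ↦ (0 : ℂ) * f 0 t from funext fun t ↦ by simp]
      exact (hf 0).const_mul 0
  have hf's : ∀ i, tsupport (f' i) ⊆ Icc (-(m * L / 2 + δ)) (m * L / 2 + δ) := fun i ↦ by
    by_cases hi : i ≤ n
    · simpa [hf'def, hi] using hfs i (Finset.mem_range.2 (Nat.lt_succ_of_le hi))
    · simp [hf'def, hi]
  have hsum : (fun t ↦ ∑ i ∈ Finset.range (n + 1), (v i : ℂ) * h (t + m * L / 2 - i * L)) = ∑ i ∈ Finset.range (n + 1), f' i := by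
    funext t
    rw [Finset.sum_apply]
    refine Finset.sum_congr rfl fun i hi ↦ ?_
    have hi' : i ≤ n := Nat.lt_succ_iff.1 (Finset.mem_range.1 hi)
    simp only [hf'def, hi', if_true, hfdef]
    ring_nf
  have hQ : ∀ i ∈ Finset.range (n + 1), (weilSemilocalQuadratic S (f' i)).re = v i ^ 2 * (weilSemilocalQuadratic S h).re := by
    intro i hi
    have hi' : i ≤ n := Nat.lt_succ_iff.1 (Finset.mem_range.1 hi)
    simp only [hf'def, hi', if_true, hfdef]
    rw [weilSemilocalQuadratic_smul_translate, Complex.re_ofReal_mul]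
  rw [hsum]
  have h := re_weilSemilocalQuadratic_sum_le hpos hf' hf's n
  rw [Finset.sum_congr rfl hQ, ← Finset.sum_mul] at h
  linarith [h]

/-! ## §4  The half-room laws with the linear constant -/

/-- **COMB TEST IN THE DELETED FORM, linear constant** (cf. `semilocalGroundEnergy_erase_comb_le`):
`λ_min(S∖{p}; mL/2 + δ; P)·|v|²‖h‖₂² ≤ (m+1)|v|²·Re Q_S(h) + (vᵀA_m(p)v)·‖h‖₂²`. -/
theorem semilocalGroundEnergy_erase_comb_le_linear (hh : IsWeilTest h) (hsupp : tsupport h ⊆ Icc (-δ) δ) (hδ0 : 0 < δ)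
    (hp : p.Prime) (hpS : p ∈ S) {m : ℕ} (hδ : 2 * δ < Real.log p) (hv : ∀ j, m < j → v j = 0)
    (hpos : WeilSemilocalPositivityOn S (m * Real.log p / 2 + δ))
    (hP : ∀ a : ℝ, 0 < a → P fun t ↦ (a : ℂ) * ∑ i ∈ Finset.range (m + 1), (v i : ℂ) * h (t + m * Real.log p / 2 - i * Real.log p)) :
    semilocalGroundEnergy (S.erase p) P (m * Real.log p / 2 + δ) *
        ((∑ i ∈ Finset.range (m + 1), v i ^ 2) * ∫ u : ℝ, ‖h u‖ ^ 2) ≤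
      (m + 1) * (∑ i ∈ Finset.range (m + 1), v i ^ 2) * (weilSemilocalQuadratic S h).re +
        (2 * ∑ e ∈ Finset.range m, Real.log p / Real.sqrt ((p : ℝ) ^ (e + 1)) *
          ∑ i ∈ Finset.range (m + 1), v i * v (i + (e + 1))) * ∫ u : ℝ, ‖h u‖ ^ 2 := by
  set L := Real.log p with hLdef
  have hL0 : 0 < L := Real.log_pos (by exact_mod_cast hp.one_lt)
  set g := fun t ↦ ∑ i ∈ Finset.range (m + 1), (v i : ℂ) * h (t + m * L / 2 - i * L) with hgdef
  have hg : IsWeilTest g := isWeilTest_comb hh v (m * L / 2) L m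
  have hgs : tsupport g ⊆ Icc (-(m * L / 2 + δ)) (m * L / 2 + δ) := tsupport_comb_subset hsupp hL0.le v (le_refl m)
  have hR := semilocalGroundEnergy_mul_le_re (S := S.erase p) (P := P) hg hgs hP
  have hm : 2 * (m * L / 2 + δ) < (m + 1) * Real.log p := by rw [← hLdef]; linarith
  have hid := weilSemilocalQuadratic_sub_erase_pow hg hp hpS hgs hm
  have hk : ∀ e ∈ Finset.range m, ((Real.log p / Real.sqrt ((p : ℝ) ^ (e + 1)) : ℝ) : ℂ) *
      (weilConv g (weilReflect g) ((e + 1) * Real.log p) + weilConv g (weilReflect g) (-((e + 1) * Real.log p))) =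
      ((Real.log p / Real.sqrt ((p : ℝ) ^ (e + 1)) *
        ((2 * ∑ i ∈ Finset.range (m + 1), v i * v (i + (e + 1))) * ∫ u : ℝ, ‖h u‖ ^ 2) : ℝ) : ℂ) := by
    intro e _
    have := weilConv_weilReflect_comb_add_neg hh hsupp hδ0 hδ hv (e + 1) (L := L) (m := m)
    rw [← hLdef, show ((e : ℝ) + 1) * L = ((e + 1 : ℕ) : ℝ) * L by push_cast; ring, this]
    push_cast; ring
  rw [Finset.sum_congr rfl hk] at hid
  have hre := congrArg Complex.re hid
  rw [Complex.sub_re, Complex.neg_re, ← Complex.ofReal_sum, Complex.ofReal_re] at hre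
  have hcost := re_weilSemilocalQuadratic_comb_le_linear hh hsupp hL0.le hpos v (le_refl m)
  rw [integral_norm_sq_comb hh hsupp hδ0 hδ hv] at hR
  have hsum : ∑ e ∈ Finset.range m, Real.log p / Real.sqrt ((p : ℝ) ^ (e + 1)) *
      ((2 * ∑ i ∈ Finset.range (m + 1), v i * v (i + (e + 1))) * ∫ u : ℝ, ‖h u‖ ^ 2) =
      (2 * ∑ e ∈ Finset.range m, Real.log p / Real.sqrt ((p : ℝ) ^ (e + 1)) *
        ∑ i ∈ Finset.range (m + 1), v i * v (i + (e + 1))) * ∫ u : ℝ, ‖h u‖ ^ 2 := by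
    rw [Finset.mul_sum, Finset.sum_mul]
    exact Finset.sum_congr rfl fun e _ ↦ by ring
  rw [hsum] at hre
  linarith

/-- **THE `(m+1)`-BLOCK HALF-ROOM LAW with linear constant, all sectors:**
`λ_min(S∖{p}; m·log p/2 + δ)·|v|² ≤ vᵀA_m(p)v + (m+1)·|v|²·λ_min(S; δ)`. -/
theorem semilocalGroundEnergy_erase_top_le_comb_linear (hp : p.Prime) (hpS : p ∈ S) {m : ℕ} (hδ0 : 0 < δ) (hδ : 2 * δ < Real.log p)
    (hpos : WeilSemilocalPositivityOn S (m * Real.log p / 2 + δ)) (hv : ∀ j, m < j → v j = 0)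
    (hv0 : 0 < ∑ i ∈ Finset.range (m + 1), v i ^ 2) :
    semilocalGroundEnergy (S.erase p) (fun _ ↦ True) (m * Real.log p / 2 + δ) * ∑ i ∈ Finset.range (m + 1), v i ^ 2 ≤
      2 * ∑ e ∈ Finset.range m, Real.log p / Real.sqrt ((p : ℝ) ^ (e + 1)) * ∑ i ∈ Finset.range (m + 1), v i * v (i + (e + 1)) +
        (m + 1) * (∑ i ∈ Finset.range (m + 1), v i ^ 2) * semilocalGroundEnergy S (fun _ ↦ True) δ := by
  set N := ∑ i ∈ Finset.range (m + 1), v i ^ 2 with hN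
  set A := 2 * ∑ e ∈ Finset.range m, Real.log p / Real.sqrt ((p : ℝ) ^ (e + 1)) *
    ∑ i ∈ Finset.range (m + 1), v i * v (i + (e + 1)) with hA
  set E := semilocalGroundEnergy (S.erase p) (fun _ ↦ True) (m * Real.log p / 2 + δ) with hE
  have hm1 : (0 : ℝ) < m + 1 := by positivity
  have key : (E * N - A) / ((m + 1) * N) ≤ semilocalGroundEnergy S (fun _ ↦ True) δ := by
    refine le_semilocalGroundEnergy (semilocalSphereValues_top_nonempty S hδ0) fun g hg hs _ hn ↦ ?_
    have := semilocalGroundEnergy_erase_comb_le_linear (P := fun _ ↦ True) hg hs hδ0 hp hpS hδ hv hpos fun _ _ ↦ trivial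
    rw [hn, mul_one, mul_one, ← hN, ← hA, ← hE] at this
    rw [div_le_iff₀ (by positivity)]
    nlinarith [this]
  have := (div_le_iff₀ (by positivity : (0 : ℝ) < (m + 1) * N)).1 key
  nlinarith [this]

/-- **The linear half-room law in a SECTOR** (`v_{m−i} = s·v_i`, blocks of parity `σ`; comb parity `sσ`):
`λ_min(S∖{p}; m·log p/2 + δ; parity sσ)·|v|² ≤ vᵀA_m(p)v + (m+1)·|v|²·λ_min(S; δ; parity σ)`. -/
theorem semilocalGroundEnergy_erase_sector_le_comb_linear (hp : p.Prime) (hpS : p ∈ S) {m : ℕ} (hδ0 : 0 < δ)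
    (hδ : 2 * δ < Real.log p) (hpos : WeilSemilocalPositivityOn S (m * Real.log p / 2 + δ)) (hv : ∀ j, m < j → v j = 0)
    (hv0 : 0 < ∑ i ∈ Finset.range (m + 1), v i ^ 2) {s σ : ℝ} (hσ : σ = 1 ∨ σ = -1)
    (hvs : ∀ i, i ≤ m → v (m - i) = s * v i) :
    semilocalGroundEnergy (S.erase p) (fun g ↦ ∀ t, g (-t) = ((s * σ : ℝ) : ℂ) * g t) (m * Real.log p / 2 + δ) *
        ∑ i ∈ Finset.range (m + 1), v i ^ 2 ≤
      2 * ∑ e ∈ Finset.range m, Real.log p / Real.sqrt ((p : ℝ) ^ (e + 1)) * ∑ i ∈ Finset.range (m + 1), v i * v (i + (e + 1)) +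
        (m + 1) * (∑ i ∈ Finset.range (m + 1), v i ^ 2) *
          semilocalGroundEnergy S (fun g ↦ ∀ t, g (-t) = ((σ : ℝ) : ℂ) * g t) δ := by
  set N := ∑ i ∈ Finset.range (m + 1), v i ^ 2 with hN
  set A := 2 * ∑ e ∈ Finset.range m, Real.log p / Real.sqrt ((p : ℝ) ^ (e + 1)) *
    ∑ i ∈ Finset.range (m + 1), v i * v (i + (e + 1)) with hA
  set E := semilocalGroundEnergy (S.erase p) (fun g ↦ ∀ t, g (-t) = ((s * σ : ℝ) : ℂ) * g t) (m * Real.log p / 2 + δ) with hE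
  have hne : (semilocalSphereValues S (fun g ↦ ∀ t, g (-t) = ((σ : ℝ) : ℂ) * g t) δ).Nonempty := by
    rcases hσ with rfl | rfl
    · simpa using semilocalSphereValues_even_nonempty S hδ0
    · have := semilocalSphereValues_odd_nonempty S hδ0
      convert this using 3; simp
  have hm1 : (0 : ℝ) < m + 1 := by positivity
  have key : (E * N - A) / ((m + 1) * N) ≤ semilocalGroundEnergy S (fun g ↦ ∀ t, g (-t) = ((σ : ℝ) : ℂ) * g t) δ := by
    refine le_semilocalGroundEnergy hne fun g hg hgs hPg hn ↦ ?_
    have := semilocalGroundEnergy_erase_comb_le_linear (P := fun g ↦ ∀ t, g (-t) = ((s * σ : ℝ) : ℂ) * g t) hg hgs hδ0 hp hpS hδ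
      hv hpos fun a _ t ↦ by
        show (a : ℂ) * ∑ i ∈ Finset.range (m + 1), (v i : ℂ) * g (-t + m * Real.log p / 2 - i * Real.log p) = _
        rw [comb_neg_apply s hvs (σ : ℂ) hPg t]; push_cast; ring
    rw [hn, mul_one, mul_one, ← hN, ← hA, ← hE] at this
    rw [div_le_iff₀ (by positivity)]
    nlinarith [this]
  have := (div_le_iff₀ (by positivity : (0 : ℝ) < (m + 1) * N)).1 key
  nlinarith [this]

end Summit.RiemannHypothesis.RiemannHypothesis.Theorems.SemilocalDeletionToeplitzCombsLinear
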